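import Mathlib
import HarnessLib
import Summits.NavierStokesRegularity.NavierStokesRegularity.Theorems.PoloidalWindowDoorLrcModEntireTwistingTHOscUniversalWeightDefs

/-!
# Item `LrcModEntire` (stmt-NavierStokesRegularity-20428), CLASS road to `stub_twistingTHGerm` — an EXPLICIT UNIVERSAL LYAPUNOV
# WEIGHT for (OSC) in similarity variables, part 1/3: the constants and the two closed-form PIECES (bounds, derivatives, `C²` matching at `ξ = A`)

Cell ns-regularity-ideate, LEAD ns-poloidal-K2-p3 g13 (`--supports stmt-NavierStokesRegularity-20428`; brick (K-w) of the kernel plan agreed with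
ns-k2-port-2 g3, OSC-SCALING-NOTE v2 §3 / OSC-LIOUVILLE-g13 §3, crux dir).

THE POINT.  In similarity variables the law (OSC) is `∂_τÔ + ½∂_ξ((ξ + Ŝ)Ô) ≤ ∂_ξξÔ` with `|Ŝ| ≤ A`.  A weight `w > 0` with
(UW) `w″(ξ) + ½(ξ + s)·w′(ξ) ≤ −γ·w(ξ)` for ALL `ξ` and ALL `|s| ≤ A` (one `γ > 0`), plus Gaussian decay of `w, w′`, makes `M(τ) := ∫Ô w` satisfy
`M′ ≤ −γM` by two integrations by parts, whence the ancient Liouville theorem for (OSC) for EVERY Lipschitz constant of `Ŝ` (port-2's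
(K-b)/(K-c)).  Port-2 obtains such a `w` as the principal Neumann eigenfunction of `w″ + ½(ξ−A)w′` (Sturm–Liouville).  This file REMOVES the
spectral input: an explicit, elementary, even `C²` weight works, with `γ = e^{−A²/2}/16`:
* on `[0, A]`:  `w(ξ) = 1 − γ·H(ξ)`, `H(ξ) = (2/A)((2/A)(e^{Aξ/2} − 1) − ξ)` (so `w′ = −γh`, `h = (2/A)(e^{Aξ/2} − 1)`, `w″ = −γe^{Aξ/2}`, and
  `w″ + ½(ξ−A)w′ = −γ(1 + (ξ/A)(e^{Aξ/2} − 1)) ≤ −γ ≤ −γw` — the point being `h′ − ½(A−ξ)h ≥ 1`);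
* on `[A, ∞)`: the `C²`-matched tail `w(ξ) = W_A·exp(−λu − κu²)`, `u = ξ − A`, `λ = γh(A)/W_A`, `κ = (λ² + γe^{A²/2}/W_A)/2 ≤ 1/8`;
* even extension to `ξ < 0`; worst case `s = −A` suffices on `ξ ≥ 0` because `w′ ≤ 0` there.
Main theorem (part 3 `…OscUniversalWeight`): `exists_universalWeight` — for every `A > 0` there are `γ, κ > 0`, `C ≥ 0` and an even `C²` weight `w > 0`, non-increasing on
`[0,∞)`, with (UW) and `|w|, |w′| ≤ C·e^{−κξ²}` — exactly the hypothesis object of port-2's (K-b).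

WHAT THIS IS NOT: not a claim about Navier–Stokes regularity and not the stub — one-variable real analysis (bears_on LADDER-NS N0, item 20428 / crux 19708;
both OPEN).
-/

noncomputable section

-- the summit and its single sub-problem share the name (CONVENTIONS §1), as in every Theorems file
set_option linter.dupNamespace false

namespace Summit.NavierStokesRegularity.NavierStokesRegularity.Theorems.PoloidalWindowDoorLrcModEntireTwistingTHOscUniversalWeightPieces

open Set Filter Topology MeasureTheory intervalIntegral
open Summit.NavierStokesRegularity.NavierStokesRegularity.Theorems.PoloidalWindowDoorLrcModEntireTwistingTHOscUniversalWeightDefs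

variable {A : ℝ}


/-! ### Elementary bounds on the constants -/

/-- `γ > 0`. -/
theorem gam_pos : 0 < gam A := by unfold gam; positivity

/-- `γ·E = 1/16`. -/
theorem gam_mul_Ec : gam A * Ec A = 1 / 16 := by
  unfold gam Ec
  rw [div_mul_eq_mul_div, ← Real.exp_add]
  norm_num

/-- `E ≥ 1`. -/
theorem one_le_Ec : 1 ≤ Ec A := by
  unfold Ec; exact Real.one_le_exp (div_nonneg (mul_self_nonneg A) (by norm_num))

/-- `h ≥ 0` on `[0,∞)`. -/
theorem hf_nonneg (hA : 0 < A) {ξ : ℝ} (hξ : 0 ≤ ξ) : 0 ≤ hf A ξ := by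
  unfold hf
  have : 1 ≤ Real.exp (A * ξ / 2) := Real.one_le_exp (by positivity)
  have : 0 ≤ 2 / A := by positivity
  nlinarith

/-- `0 ≤ H(ξ) ≤ (4/A²)(e^{Aξ/2} − 1)` for `ξ ≥ 0`. -/
theorem Hf_nonneg (hA : 0 < A) (ξ : ℝ) : 0 ≤ Hf A ξ := by
  unfold Hf
  have h1 : A * ξ / 2 + 1 ≤ Real.exp (A * ξ / 2) := Real.add_one_le_exp _
  have h2 : ξ ≤ (2 / A) * (Real.exp (A * ξ / 2) - 1) := by
    rw [div_mul_eq_mul_div, le_div_iff₀ hA]; nlinarith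
  have : 0 ≤ 2 / A := by positivity
  nlinarith

/-- `H(ξ) ≤ (4/A²)(e^{Aξ/2} − 1)` for `ξ ≥ 0`. -/
theorem Hf_le (hA : 0 < A) {ξ : ℝ} (hξ : 0 ≤ ξ) : Hf A ξ ≤ (4 / (A * A)) * (Real.exp (A * ξ / 2) - 1) := by
  unfold Hf
  have : 0 ≤ 2 / A := by positivity
  have e : (4 / (A * A)) * (Real.exp (A * ξ / 2) - 1) = (2 / A) * ((2 / A) * (Real.exp (A * ξ / 2) - 1)) := by
    field_simp; ring
  rw [e]
  exact mul_le_mul_of_nonneg_left (by linarith) this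

/-- `γ·H(ξ) ≤ 1/8` on `[0, A]`. -/
theorem gam_Hf_le (hA : 0 < A) {ξ : ℝ} (hξ : 0 ≤ ξ) (hξA : ξ ≤ A) : gam A * Hf A ξ ≤ 1 / 8 := by
  have h1 := Hf_le hA hξ
  have hmono : Real.exp (A * ξ / 2) ≤ Ec A := by
    unfold Ec; exact Real.exp_le_exp.2 (by nlinarith)
  have h2 : Real.exp (A * A / 2) - 1 ≤ (A * A / 2) * Real.exp (A * A / 2) := by
    -- `e^x − 1 ≤ x e^x` from `1 − x ≤ e^{−x}` (cf. `Literature…AreaLaw.exp_sub_one_le_mul_exp`)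
    have h := Real.add_one_le_exp (-(A * A / 2))
    have hpos := Real.exp_pos (A * A / 2)
    have e : Real.exp (-(A * A / 2)) * Real.exp (A * A / 2) = 1 := by rw [← Real.exp_add]; simp
    nlinarith [mul_le_mul_of_nonneg_right h hpos.le]
  have hg := gam_pos (A := A)
  have hgE := gam_mul_Ec (A := A)
  unfold Ec at hmono hgE
  have hAA : 0 < A * A := by positivity
  have h3 : gam A * Hf A ξ ≤ gam A * ((4 / (A * A)) * (Real.exp (A * A / 2) - 1)) := by
    refine mul_le_mul_of_nonneg_left (h1.trans ?_) hg.le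
    exact mul_le_mul_of_nonneg_left (by linarith) (by positivity)
  have h4 : gam A * ((4 / (A * A)) * (Real.exp (A * A / 2) - 1)) ≤ gam A * ((4 / (A * A)) * ((A * A / 2) * Real.exp (A * A / 2))) :=
    mul_le_mul_of_nonneg_left (mul_le_mul_of_nonneg_left h2 (by positivity)) hg.le
  have e : gam A * ((4 / (A * A)) * ((A * A / 2) * Real.exp (A * A / 2))) = 2 * (gam A * Real.exp (A * A / 2)) := by
    field_simp; ring
  rw [e, hgE] at h4
  linarith

/-- `W_A ≤ 1`. -/
theorem WA_le_one (hA : 0 < A) : WA A ≤ 1 := by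
  unfold WA wL; linarith [mul_nonneg (gam_pos (A := A)).le (Hf_nonneg hA A)]

/-- `W_A ≥ 7/8`. -/
theorem WA_ge (hA : 0 < A) : 7 / 8 ≤ WA A := by
  unfold WA wL; linarith [gam_Hf_le hA hA.le le_rfl]

/-- `W_A > 0`. -/
theorem WA_pos (hA : 0 < A) : 0 < WA A := by linarith [WA_ge hA]

/-- `λ ≥ 0`. -/
theorem lam_nonneg (hA : 0 < A) : 0 ≤ lam A := by
  unfold lam; exact div_nonneg (mul_nonneg (gam_pos (A := A)).le (hf_nonneg hA hA.le)) (WA_pos hA).le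

/-- `λ·W_A = γ·h(A)` (the `C¹` matching). -/
theorem lam_mul_WA (hA : 0 < A) : lam A * WA A = gam A * hf A A := by
  unfold lam; field_simp [(WA_pos hA).ne']

/-- `γ·h(A) ≤ 1/8` (both for `A ≤ 1` and `A ≥ 1`). -/
theorem gam_hf_le (hA : 0 < A) : gam A * hf A A ≤ 1 / 8 := by
  have hg := gam_pos (A := A)
  have hgE := gam_mul_Ec (A := A)
  unfold Ec at hgE
  unfold hf
  set E := Real.exp (A * A / 2) with hE
  have hE1 : 1 ≤ E := Real.one_le_exp (by positivity)
  by_cases hA1 : A ≤ 1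
  · -- `e^{A²/2} − 1 ≤ (A²/2)E` ⇒ `γ(2/A)(E−1) ≤ γ A E = A/16 ≤ 1/16`
    have h2 : E - 1 ≤ (A * A / 2) * E := by
      -- `e^x − 1 ≤ x e^x` from `1 − x ≤ e^{−x}` (cf. `Literature…AreaLaw.exp_sub_one_le_mul_exp`)
      rw [hE]
      have h := Real.add_one_le_exp (-(A * A / 2))
      have hpos := Real.exp_pos (A * A / 2)
      have e : Real.exp (-(A * A / 2)) * Real.exp (A * A / 2) = 1 := by rw [← Real.exp_add]; simp
      nlinarith [mul_le_mul_of_nonneg_right h hpos.le]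
    have h3 : gam A * ((2 / A) * (E - 1)) ≤ gam A * ((2 / A) * ((A * A / 2) * E)) :=
      mul_le_mul_of_nonneg_left (mul_le_mul_of_nonneg_left h2 (by positivity)) hg.le
    have e : gam A * ((2 / A) * ((A * A / 2) * E)) = A * (gam A * E) := by field_simp
    rw [e, hgE] at h3
    linarith
  · -- `E − 1 ≤ E` ⇒ `γ(2/A)(E−1) ≤ (2/A)/16 ≤ 1/8`
    push Not at hA1
    have h3 : gam A * ((2 / A) * (E - 1)) ≤ gam A * ((2 / A) * E) :=
      mul_le_mul_of_nonneg_left (mul_le_mul_of_nonneg_left (by linarith) (by positivity)) hg.le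
    have e : gam A * ((2 / A) * E) = (2 / A) * (gam A * E) := by ring
    rw [e, hgE] at h3
    have h4 : 2 / A ≤ 2 := by rw [div_le_iff₀ hA]; linarith
    linarith

/-- `λ ≤ 1/7`. -/
theorem lam_le (hA : 0 < A) : lam A ≤ 1 / 7 := by
  have h := lam_mul_WA hA
  have h1 := gam_hf_le hA
  have h2 := WA_ge hA
  have h3 := lam_nonneg hA
  nlinarith

/-- `κ > 0`. -/
theorem kap_pos (hA : 0 < A) : 0 < kap A := by
  unfold kap
  have : 0 < gam A * Ec A / WA A := div_pos (by rw [gam_mul_Ec]; norm_num) (WA_pos hA)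
  positivity

/-- `κ ≤ 1/8`. -/
theorem kap_le (hA : 0 < A) : kap A ≤ 1 / 8 := by
  unfold kap
  have h1 := lam_le hA
  have h0 := lam_nonneg hA
  have h2 : gam A * Ec A / WA A ≤ (1 / 16) / (7 / 8) := by
    rw [gam_mul_Ec]; exact div_le_div_of_nonneg_left (by norm_num) (by norm_num) (WA_ge hA)
  nlinarith

/-- `λ² − 2κ = −γE/W_A ≤ −γ`. -/
theorem lam_sq_sub : lam A ^ 2 - 2 * kap A = -(gam A * Ec A / WA A) := by unfold kap; ring

/-- `γ ≤ γE/W_A`. -/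
theorem gam_le_gamE_div (hA : 0 < A) : gam A ≤ gam A * Ec A / WA A := by
  rw [le_div_iff₀ (WA_pos hA)]
  have := WA_le_one hA
  have := one_le_Ec (A := A)
  have := gam_pos (A := A)
  nlinarith

/-! ### Derivatives of the closed-form pieces -/

/-- `H′ = h`. -/
theorem hasDerivAt_Hf (hA : 0 < A) (ξ : ℝ) : HasDerivAt (Hf A) (hf A ξ) ξ := by
  have h1 : HasDerivAt (fun x : ℝ => A * x / 2) (A / 2) ξ := by
    simpa using ((hasDerivAt_id ξ).const_mul A).div_const 2
  have h2 : HasDerivAt (fun x : ℝ => Real.exp (A * x / 2)) (Real.exp (A * ξ / 2) * (A / 2)) ξ := h1.exp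
  have h3 : HasDerivAt (fun x : ℝ => (2 / A) * ((2 / A) * (Real.exp (A * x / 2) - 1) - x))
      ((2 / A) * ((2 / A) * (Real.exp (A * ξ / 2) * (A / 2)) - 1)) ξ :=
    (((h2.sub_const 1).const_mul (2 / A)).sub (hasDerivAt_id ξ)).const_mul (2 / A)
  refine h3.congr_deriv ?_
  unfold hf; field_simp

/-- `h′(ξ) = e^{Aξ/2}` (or `A = 0`). -/
theorem hasDerivAt_hf (ξ : ℝ) : HasDerivAt (hf A) (Real.exp (A * ξ / 2)) ξ ∨ A = 0 := by
  by_cases hA : A = 0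
  · exact Or.inr hA
  · left
    have h1 : HasDerivAt (fun x : ℝ => A * x / 2) (A / 2) ξ := by
      simpa using ((hasDerivAt_id ξ).const_mul A).div_const 2
    have h3 : HasDerivAt (fun x : ℝ => (2 / A) * (Real.exp (A * x / 2) - 1)) ((2 / A) * (Real.exp (A * ξ / 2) * (A / 2))) ξ :=
      (h1.exp.sub_const 1).const_mul (2 / A)
    refine h3.congr_deriv ?_
    field_simp

/-- `w_L′ = −γh`. -/
theorem hasDerivAt_wL (hA : 0 < A) (ξ : ℝ) : HasDerivAt (wL A) (-gam A * hf A ξ) ξ := by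
  have h := ((hasDerivAt_Hf hA ξ).const_mul (gam A)).const_sub 1
  refine h.congr_deriv ?_
  ring

/-- `(−γh)′ = gL = w_L″`. -/
theorem hasDerivAt_wL1 (hA : 0 < A) (ξ : ℝ) : HasDerivAt (fun x => -gam A * hf A x) (gL A ξ) ξ := by
  rcases hasDerivAt_hf (A := A) ξ with h | h
  · refine (h.const_mul (-gam A)).congr_deriv ?_
    unfold gL; ring
  · exact absurd h hA.ne'

/-- `q′ = λ + 2κ(ξ−A)`. -/
theorem hasDerivAt_qf (ξ : ℝ) : HasDerivAt (qf A) (lam A + 2 * kap A * (ξ - A)) ξ := by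
  have h1 : HasDerivAt (fun x : ℝ => x - A) 1 ξ := (hasDerivAt_id ξ).sub_const A
  have h2 := (h1.const_mul (lam A)).add ((h1.fun_pow 2).const_mul (kap A))
  refine h2.congr_deriv ?_
  simp; ring

/-- `w_R′ = wR1`. -/
theorem hasDerivAt_wR (ξ : ℝ) : HasDerivAt (wR A) (wR1 A ξ) ξ := by
  have h := ((hasDerivAt_qf (A := A) ξ).fun_neg.exp).const_mul (WA A)
  refine h.congr_deriv ?_
  unfold wR1 wR; ring

/-- `wR1′ = wR2`. -/
theorem hasDerivAt_wR1 (ξ : ℝ) : HasDerivAt (wR1 A) (wR2 A ξ) ξ := by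
  have h1 : HasDerivAt (fun x : ℝ => -(lam A + 2 * kap A * (x - A))) (-(2 * kap A)) ξ := by
    have h := (((hasDerivAt_id ξ).sub_const A).const_mul (2 * kap A)).const_add (lam A)
    simpa using h.fun_neg
  have h := h1.fun_mul (hasDerivAt_wR (A := A) ξ)
  refine h.congr_deriv ?_
  unfold wR2 wR1; ring

/-! ### Matching at `ξ = A` -/

/-- Value matching at `A`: `w_R(A) = W_A`. -/
theorem wR_at : wR A A = WA A := by unfold wR qf; simp

/-- First-derivative matching at `A`: `w_R′(A) = −γh(A) = w_L′(A)`. -/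
theorem wR1_at (hA : 0 < A) : wR1 A A = -gam A * hf A A := by
  unfold wR1; rw [wR_at]; simp [lam_mul_WA hA]

/-- Second-derivative matching at `A`: `w_R″(A) = −γE = w_L″(A)` (the choice of `κ`). -/
theorem wR2_at (hA : 0 < A) : wR2 A A = gL A A := by
  unfold wR2 gL
  rw [wR_at]
  have h1 : (lam A + 2 * kap A * (A - A)) ^ 2 - 2 * kap A = -(gam A * Ec A / WA A) := by
    rw [sub_self, mul_zero, add_zero]; exact lam_sq_sub
  rw [h1]
  unfold Ec
  field_simp [(WA_pos hA).ne']

end Summit.NavierStokesRegularity.NavierStokesRegularity.Theorems.PoloidalWindowDoorLrcModEntireTwistingTHOscUniversalWeightPieces
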